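import Literature.Analysis.FluidPDE.NSHopfLimit
import Summits.AnomalousDissipation.AnomalousDissipation.Theorems.TaylorGreenLoudGalerkinStates.Negative.Anatomy
import HarnessLib

/-!
# Crux `PumpedMirror.MirrorBoundedFromRestTG` (stmt-AnomalousDissipation-15373), line `birth`:
# the ν-uniform TRANSIENT part of stub B′ (`stub_galerkinCeilingFromRest`)

Stub B′ of the registered skeleton asks for a pathwise energy ceiling `∫ |U n t|² ≤ E`, all `t ≥ 0`,
uniform in the viscosity and in the (resolved) Galerkin order, for the exact-force Hopf–Galerkin
schemes of the Taylor–Green force from rest. This support file proves the part of it that energy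
methods DO give uniformly: on every initial window the energy of ANY exact-force scheme from rest
is bounded independently of `ν ≥ 0` and of the order,

  `∫ |U n t|² ≤ 4 t² ∫ |f|²`   (`integral_norm_sq_le_sq_mul_of_rest`, any steady force `f`),

so for `f = f_TG` (`∫ |f_TG|² = 1/4`): `∫ |U n t|² ≤ t²` (`tg_galerkin_energy_le_sq`; this is the
REGISTERED stub `stub_galerkinTransientFromRest` of the reshaped birth skeleton, proved below). Consequently
B′ holds on `[0, √E]` for free and is a statement about LATE times only
(`tg_galerkin_ceiling_iff_late`). The proof is the tree's uniform `L²` bound for Galerkin schemes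
(Robinson–Rodrigo–Sadowski 2016, (4.8)–(4.9): energy identity + Young,
`IsHopfGalerkinScheme.integral_norm_sq_le`) with the datum `0` (`integral_norm_sq_zero_le`) and
the exact steady force, whose space–time norm on `(0, t)` is `t ∫ |f|²`.

References: J. C. Robinson, J. L. Rodrigo, W. Sadowski, *The three-dimensional Navier–Stokes
equations* (CUP 2016), Thm. 4.4 Step 3, (4.8)–(4.9).
-/

-- the mandated namespace repeats `AnomalousDissipation` (single-conjunct summit)
set_option linter.dupNamespace false

noncomputable section

open MeasureTheory Set Filter
open scoped ENNReal NNReal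

namespace Summit.AnomalousDissipation.AnomalousDissipation.Theorems.PumpedMirror.MirrorBoundedFromRestTG.Transient

open Literature.Analysis.FluidPDE Literature.Analysis.FunctionSpaces
open Summit.AnomalousDissipation.AnomalousDissipation.Theorems.TaylorGreenLoudGalerkinStates.Negative

variable {d : Type*} [Fintype d] [DecidableEq d]

omit [DecidableEq d] in
/-- The space–time `L²` norm of a steady continuous force on the strip `(0, t) × T^d` is
`t · ∫ |f|²` (as an extended real: `≤ ofReal (t ∫ |f|²)`, in fact with equality). [folklore] -/
theorem lintegral_steady_force_le {f : UnitAddTorus d → EuclideanSpace ℝ d} (hf : Continuous f)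
    {t : ℝ} (ht : 0 ≤ t) (n : ℕ) :
    ∫⁻ τ in Ioo 0 t, ∫⁻ x, ‖(fun (_ : ℕ) (_ : ℝ) => f) n τ x‖ₑ ^ 2 ≤
      ENNReal.ofReal (t * ∫ x, ‖f x‖ ^ 2) := by
  have hint : Integrable (fun x => ‖f x‖ ^ 2) volume := (hf.norm.pow 2).integrable_unitAddTorus
  have hinner : ∫⁻ x, ‖f x‖ₑ ^ 2 = ENNReal.ofReal (∫ x, ‖f x‖ ^ 2) := by
    rw [ofReal_integral_eq_lintegral_ofReal hint (ae_of_all _ fun x => by positivity)]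
    refine lintegral_congr fun x => ?_
    rw [← ofReal_norm, ENNReal.ofReal_pow (norm_nonneg _)]
  show ∫⁻ _ in Ioo 0 t, ∫⁻ x, ‖f x‖ₑ ^ 2 ≤ ENNReal.ofReal (t * ∫ x, ‖f x‖ ^ 2)
  rw [setLIntegral_const, hinner, Real.volume_Ioo, sub_zero,
    ENNReal.ofReal_mul ht]
  exact le_of_eq (mul_comm _ _)

/-- **ν-uniform, order-uniform transient bound for exact-force Galerkin schemes from rest.** For a
Hopf–Galerkin scheme of the forced Navier–Stokes system on `T^d` with `ν ≥ 0`, datum `0` and the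
force pinned to a steady continuous field `f` at every order (`F n t = f`), every approximation
satisfies `∫ |U n t|² ≤ 4 t² ∫ |f|²` for all `t ≥ 0` — independently of `ν` and of `n`
(Robinson–Rodrigo–Sadowski 2016, (4.8): energy identity from `0` plus Young with `η = 1/(2t)`;
the initial energy vanishes because `U n 0 = P_{N n} 0 = 0`). [cite: RobinsonRodrigoSadowski2016, Thm. 4.4 Step 3 (4.8)] -/
theorem integral_norm_sq_le_sq_mul_of_rest {ν : ℝ} {f : UnitAddTorus d → EuclideanSpace ℝ d}
    {N : ℕ → ℕ} {U : ℕ → ℝ → UnitAddTorus d → EuclideanSpace ℝ d}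
    (hS : IsHopfGalerkinScheme ν (fun _ => f) 0 N (fun _ _ => f) U) (hν : 0 ≤ ν)
    (hf : Continuous f) (n : ℕ) {t : ℝ} (ht : 0 ≤ t) :
    ∫ x, ‖U n t x‖ ^ 2 ≤ 4 * t ^ 2 * ∫ x, ‖f x‖ ^ 2 := by
  -- from rest the initial energy vanishes
  have h0 : ∫ x, ‖U n 0 x‖ ^ 2 ≤ 0 := by
    have h := hS.integral_norm_sq_zero_le (MemLp.zero' (ε := EuclideanSpace ℝ d)) n
    simpa using h
  have hF0 : 0 ≤ ∫ x, ‖f x‖ ^ 2 := integral_nonneg fun x => by positivity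
  rcases eq_or_lt_of_le ht with rfl | htpos
  · simpa using h0
  -- the uniform `L²` bound on `[0, t]` with the exact force
  have hA := lintegral_steady_force_le hf htpos.le n
  have h := hS.integral_norm_sq_le hν htpos ENNReal.ofReal_ne_top n hA (t := t) ⟨htpos.le, le_rfl⟩
  rw [ENNReal.toReal_ofReal (mul_nonneg htpos.le hF0)] at h
  nlinarith

/-- **The Taylor–Green transient from rest is `O(t²)` uniformly in `ν` and in the order**: for
every exact-force Hopf–Galerkin scheme of `NS_ν(f_TG)` from rest (`ν ≥ 0`) and every `n`,
`t ≥ 0`: `∫ |U n t|² ≤ t²` (`∫ |f_TG|² = 1/4`, `Negative.integral_norm_sq_tgForce`). [folklore] -/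
theorem tg_galerkin_energy_le_sq {ν : ℝ} (hν : 0 ≤ ν) {N : ℕ → ℕ}
    {U : ℕ → ℝ → UnitAddTorus (Fin 3) → EuclideanSpace ℝ (Fin 3)}
    (hS : IsHopfGalerkinScheme ν (fun _ => tgForce) 0 N (fun _ _ => tgForce) U) (n : ℕ) {t : ℝ}
    (ht : 0 ≤ t) : ∫ x, ‖U n t x‖ ^ 2 ≤ t ^ 2 := by
  have h := integral_norm_sq_le_sq_mul_of_rest hS hν isSmooth_tgForce.continuous n ht
  rw [integral_norm_sq_tgForce] at h
  linarith

/-- **B′ is a statement about late times.** For `E > 0`, `ν ≥ 0` and an exact-force Hopf–Galerkin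
scheme of `NS_ν(f_TG)` from rest, the pathwise ceiling `∫ |U n t|² ≤ E` for ALL `t ≥ 0` (at the
orders `n` of any set `S`) is equivalent to the same ceiling for `t ≥ √E` only: on `[0, √E]` it holds
for free by `tg_galerkin_energy_le_sq`. [folklore] -/
theorem tg_galerkin_ceiling_iff_late {ν E : ℝ} (hν : 0 ≤ ν) (hE : 0 < E) {N : ℕ → ℕ}
    {U : ℕ → ℝ → UnitAddTorus (Fin 3) → EuclideanSpace ℝ (Fin 3)}
    (hS : IsHopfGalerkinScheme ν (fun _ => tgForce) 0 N (fun _ _ => tgForce) U) (S : Set ℕ) :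
    (∀ n ∈ S, ∀ t : ℝ, 0 ≤ t → ∫ x, ‖U n t x‖ ^ 2 ≤ E) ↔
      ∀ n ∈ S, ∀ t : ℝ, Real.sqrt E ≤ t → ∫ x, ‖U n t x‖ ^ 2 ≤ E := by
  refine ⟨fun h n hn t ht => h n hn t ((Real.sqrt_nonneg E).trans ht), fun h n hn t ht => ?_⟩
  rcases le_or_gt (Real.sqrt E) t with hle | hlt
  · exact h n hn t hle
  · calc ∫ x, ‖U n t x‖ ^ 2 ≤ t ^ 2 := tg_galerkin_energy_le_sq hν hS n ht
      _ ≤ (Real.sqrt E) ^ 2 := by gcongr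
      _ = E := Real.sq_sqrt hE.le

/-! ## The registered stub `stub_galerkinTransientFromRest` of the reshaped birth skeleton -/

/-- **Stub B′₁ of the crux skeleton (registered 2026-08-17): the ν-uniform, order-uniform transient from
rest.** For the pinned Taylor–Green force, EVERY `ν ≥ 0`, every exact-force Hopf–Galerkin scheme for
`(ν, f_TG, 0)`, every order `n` and every `t ≥ 0`: `∫ |U n t|² ≤ t²` (`tg_galerkin_energy_le_sq`; the
crux's force lambda is definitionally `Negative.tgForce`). [folklore] -/
theorem stub_galerkinTransientFromRest :
    ∀ f : UnitAddTorus (Fin 3) → EuclideanSpace ℝ (Fin 3), f = (fun x => !₂[(fourier 1 (x 0) : ℂ).im * (fourier 1 (x 1) : ℂ).re * (fourier 1 (x 2) : ℂ).re, -((fourier 1 (x 0) : ℂ).re * (fourier 1 (x 1) : ℂ).im * (fourier 1 (x 2) : ℂ).re), (0 : ℝ)]) →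
      ∀ ν : ℝ, 0 ≤ ν →
        ∀ (N : ℕ → ℕ) (U : ℕ → ℝ → UnitAddTorus (Fin 3) → EuclideanSpace ℝ (Fin 3)),
          Literature.Analysis.FluidPDE.IsHopfGalerkinScheme ν (fun _ => f) 0 N (fun _ _ => f) U →
          ∀ (n : ℕ) (t : ℝ), 0 ≤ t → ∫ x, ‖U n t x‖ ^ 2 ≤ t ^ 2 := by
  intro f hf ν hν N U hS n t ht
  subst hf
  exact tg_galerkin_energy_le_sq hν hS n ht

end Summit.AnomalousDissipation.AnomalousDissipation.Theorems.PumpedMirror.MirrorBoundedFromRestTG.Transient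

end
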